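import Summits.HodgeConjecture.HodgeConjecture.Theorems.F0P2cSocketC                          -- ★ (C♭) frame currency `rhoAtLine … ιV a χ`, `HasFinComponent`; ★ CI
import Summits.HodgeConjecture.HodgeConjecture.Theorems.H413MirrorAtPinLine                   -- ★ J: `exists_conjPartner_omegaAtLine_neg` (conjugate-linear partner, HodgeCM currency)
import Summits.HodgeConjecture.HodgeConjecture.Theorems.K2E2TrHasFinComponentOfBijective      -- ★ socket #6 (p854793): `HasFinComponent` along a bijective intertwiner
import Literature.NumberTheory.Automorphic.UnitaryGroupCohomologicalFormsConjRep              -- ★ `ConjVec.repConj`, `hasFinComponent_conj_repConj`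
import Literature.NumberTheory.Automorphic.UnitaryGroupCotangentSpectralProjectionConj        -- ★ `DiscreteAutomorphicRep.conj`, `isHolCotangentAt_iff_conj`
import Literature.NumberTheory.Automorphic.Liu2021.CohHolMeetsThetaLiftFromLine               -- THE LETTER #113 frame (`cmArchSection`, `cmCompactFactor`, pinned `ιA`)
import Literature.NumberTheory.Automorphic.Liu2021.ThetaLiftFromLineCoinvariantJunction       -- ★ `finPart`, `cmAdelicFrameTransport` (pinned transports)
import Literature.NumberTheory.Automorphic.Liu2021.Def411ChiGaloisTwist                       -- ★ `isAutomorphicOneChar_unitsMap_comp_chi` (`χ̄ ∈ Chi`)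
import Literature.AlgebraicGeometry.Liu2021.AdmissibleElement                                  -- ★ `isAdmissibleElement_conj_neg_iff`
import Summits.HodgeConjecture.HodgeConjecture.Theorems.K2E2OrConjLinearPartnerAtLineFramed   -- ★ #17R (p855369, K2E2-p06) RE-TIE BY IMPORT (ED. 3)
import Summits.HodgeConjecture.HodgeConjecture.Theorems.K2E2OrAntiholWitnessOfNeg   -- ★ #18 (p855379, K2E2-p03) RE-TIE BY IMPORT (ED. 3)
import HarnessLib

/-!
ED. 3: #17R and #18 RE-TIED BY IMPORT to ★ p855369 (K2E2-p06) ∕ ★ p855379 (K2E2-p03); only the superseded #17 keeps its `sorry` (frozen, never to be proved).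

ED. 2 (2026-09-03T21:58Z): + #17R `sig_K2E2OrConjLinearPartnerAtLineFramed` (R8 (b) twin of #17 with the frame binders `ι T hT hpos`; holder K2E2-p06);
#17 SUPERSEDED (bytes frozen); + `set_option linter.dupNamespace false` (r01 F1).  Sockets live: #17R (M, p06), #18 (M standalone, p03).

# K2 ∕ E2 «ThetaExhaustionByRigidity» — tier-1 sockets, unit **ORIENT** (the negative orientation `ι ∉ Φ_μ` has an ANTIholomorphic carrier)

Track B «K2-LIT», engine E2, crux H413 (`stmt-HodgeConjecture-24833`), route `route-HodgeConjecture-HCCMUnconditional`.  Tier-0 line: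
`Cruxes/H413/Lines/K2_E2_ThetaExhaustionByRigidity.lean` ED. 4 (stub `stub_antiholWitnessOfNeg`, `def StubAntiholWitnessOfNeg`).  R8 RE-CUT (dealer's self-flag
2026-09-03T21:13:25Z; K2E2-p06's pre-write flag 21:19:09Z ADOPTED): the holomorphic theta engine needs `ι ∈ Φ_μ`; at `ι ∉ Φ_μ` the theta forms of Φ_μ-admissible data
are antiholomorphic at `(ι, T)`.  In rank 3 the label `(μ, [a], χ)` of a finite component is UNIQUE ([Liu2021, Lem. D.1 (3)] — the companion `μᶜ·χ̌` of Lem. D.1 (4) is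
the rank-2 phenomenon), so there is NO ℂ-linear relabelling of a fixed `P`; instead the negative orientation is CONTRADICTORY for the holomorphic `P` of #113: a
negatively oriented admissible weight-one label has an ANTIholomorphic carrier `P″` (this unit), and the junction letter E2′ `Rogawski1990.hodgeTypeRigid` forbids a
holomorphic and an antiholomorphic discrete representation to share a finite component.  Sockets `theorem sig_K2E2Or… : ‹statement› := by sorry`, one per planned
tier-2 file `Theorems/K2E2Or….lean`; no `def`∕`instance`∕`notation`; imports ★ Theorems ∕ Literature only (built); the closer `sig_K2E2OrAntiholWitnessOfNeg` =
tier-0 `StubAntiholWitnessOfNeg` VERBATIM.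

| # | socket | size | deps | tier-2 target |
|---|---|---|---|---|
| 17 | `sig_K2E2OrConjLinearPartnerAtLine` (OR-1) | M | ★ `H413MirrorAtPinLine` (J, `exists_weightOne_mirror_sChiD`), ★ `ConjVec.repConj`, ★ `isAdmissibleElement_conj_neg_iff`, currency adapter | `Theorems/K2E2OrConjLinearPartnerAtLine.lean` |
| 18 | `sig_K2E2OrAntiholWitnessOfNeg` (OR-2, closer) | S given #17 + #12R | #17, `Capture.sig_K2E2CapHolThetaWitnessOriented` (#12R), ★ `isDiscretelyDecomposable_rightRegular_adelicGroupData`, ★ `isHolCotangentAt_iff_conj`, ★ `hasFinComponent_conj_repConj`, ★ #6 `trHasFinComponentOfBijective` | `Theorems/K2E2OrAntiholWitnessOfNeg.lean` |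

HONEST LABEL: HC_CM is proved only modulo the 7 printed citations (2 remaining named inputs: hLiu418 = stmt-HodgeConjecture-24832, h413 =
stmt-HodgeConjecture-24833) until rung 0 closes.
-/

noncomputable section

namespace Summit.HodgeConjecture.HodgeConjecture.Cruxes.H413.K2E2ThetaExhaustionByRigidity.Orient

set_option linter.dupNamespace false  -- cell standard (r01 (B1) FIX-LIST F1, ED. 2)

open scoped TensorProduct Matrix ComplexOrder
open NumberField NumberField.InfinitePlace IsDedekindDomain MeasureTheory
open Literature.NumberTheory Literature.NumberTheory.Automorphic Literature.NumberTheory.Automorphic.UnitaryGroup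
open Literature.NumberTheory.Automorphic.UnitaryGroup.CotangentForms
open Literature.NumberTheory.Automorphic.Liu2021
open Literature.NumberTheory.Automorphic.Liu2021.Def411WeilCarriers
open Literature.NumberTheory.Automorphic.Liu2021.Def411WeilCarriersDoubling
open Literature.NumberTheory.Automorphic.IdeleClassGroup
open Literature.NumberTheory.GelbartRogawski1991 Literature.NumberTheory.GelbartRogawski1991.UnitaryDualPair
open Literature.NumberTheory.GelbartRogawski1991.UnitaryDualPair.WeilCoinv
open Literature.RepresentationTheory Literature.RepresentationTheory.Liu2021
open Literature.AlgebraicGeometry.Liu2021 (IsAdmissibleElement)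
open Summit.HodgeConjecture.CorCM
open Summit.HodgeConjecture.CorCM.Transposition

set_option synthInstance.maxHeartbeats 400000 in
set_option maxHeartbeats 16000000 in
/-- **[SUPERSEDED ED. 2 by #17R `sig_K2E2OrConjLinearPartnerAtLineFramed` below — bytes FROZEN, DO NOT PROVE: true as typed but its frame-free road is L∕XL (K2E2-p06 🟠📐 21:44:01Z)]** **sig OR-1 `sig_K2E2OrConjLinearPartnerAtLine` (#17, size M) — THE CONJUGATE PARTNER OF `ω_H(μ, a, χ)[ιV]`, ℂ-LINEARLY, IN THE GENERIC CURRENCY.**  For `μ`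
conjugate-symplectic of weight one, `a ∈ (L⁺)ˣ`, `χ ∈ Chi`, general frame `(e₁, dV, g, ιV)`: there is a partner `μ′` conjugate-symplectic OF WEIGHT ONE whose CM type
is the COMPLEMENT of `Φ_μ` (`τ ∈ Φ_(μ′) ↔ τ ∉ Φ_μ`), with the admissibility transfer `a·(2δ)⁻¹` `Φ_μ`-admissible ⟹ `(−a)·(2δ)⁻¹` `Φ_(μ′)`-admissible, and a BIJECTIVE
ℂ-linear intertwiner `repConj (ω_H(μ′, −a, χ̄)[ιV]) → ω_H(μ, a, χ)[ιV]` (`χ̄ = conj ∘ χ`).  PLAN: ★ `H413MirrorAtPinLine.exists_conjPartner_omegaAtLine_neg` gives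
`μ′` (weight one, `HasCMType μ′ Φ̄`) and a bijective CONJUGATE-linear `rhoVAtLine`-equivariant `J : ω(μ,⟨a⟩,χ) → ω(μ′,⟨−a⟩,χ̄)` in the HodgeCM currency (`frameD V`,
`hsChiD`); `e := (toConj ∘ J)⁻¹` read through the currency adapter (★ `cmFieldOf` ∕ `hermSpace3Of`, `F0P2OccGenCotangentOfOccursIn`; or re-run ★ §1–§3 of
`H413MirrorAtPinLine` at `isCompatible_chiSplittingLine`) is ℂ-linear, bijective and `rhoAtLine … ιV`-equivariant (pull back along `ιV`); the CM-type clause is ★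
`HasCMType` uniqueness for `hμ′.cmType` + `bar`; admissibility is ★ `Literature.AlgebraicGeometry.Liu2021.isAdmissibleElement_conj_neg_iff` (`{τ′ | conjugate τ′ ∈ Φ} = Φ̄`).
Why it might fail: currency adapter bookkeeping only ([Liu2021, Lem. D.1 (2)] is the printed content: `ω(μ,ε,χ)̄ ≅ ω(μ̄-partner, …)`); no mathematical risk known.
[cite: Liu2021, Def. 4.11 (l. 2092–2096); App. D Lem. D.1 (2) (l. 5231); Rem. 4.4] [cite: GelbartRogawski1991, §3.1 Prop. 3.1.1 p. 455; Remark p. 457] [cite: Li1992, p. 181]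
[cite: Clozel1990, §3.1]
size: M · deps: ★ `H413MirrorAtPinLine`, ★ `ConjVec.repConj`, ★ admissibility neg-iff · unit: ORIENT · tier-2 target `Theorems/K2E2OrConjLinearPartnerAtLine.lean` -/
theorem sig_K2E2OrConjLinearPartnerAtLine :
    ∀ (L : Type) [Field L] [NumberField L] [IsCMField L] (H : Matrix (Fin 3) (Fin 3) L),
    ∀ {n' : ℕ} (e₁ : Fin 3 × Fin 1 ≃ Fin n') (dV : Fin 3 → L) (hdV : ∀ i, IsCMField.complexConj L (dV i) = dV i)
      (hdV0 : ∀ i, dV i ≠ 0) (g : GL (Fin 3) L)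
      (hg : ((g : Matrix (Fin 3) (Fin 3) L).map (cmConjRingHom L))ᵀ * H * (g : Matrix (Fin 3) (Fin 3) L) = Matrix.diagonal dV)
      (ιV : finAdelic (↥(maximalRealSubfield L)) L (IsCMField.complexConj L) 3 H →*
          finAdelic (↥(maximalRealSubfield L)) L (IsCMField.complexConj L) 3 (Matrix.diagonal dV)),
        (∀ k, ((ιV k : finAdelic (↥(maximalRealSubfield L)) L (IsCMField.complexConj L) 3 (Matrix.diagonal dV)) :
            GL (Fin 3) (FiniteAdeleRing (𝓞 L) L)) =
          (toFinAdeleGL L 3 g)⁻¹ * (k : GL (Fin 3) (FiniteAdeleRing (𝓞 L) L)) * toFinAdeleGL L 3 g) →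
      ∀ (μ : Literature.NumberTheory.Automorphic.IdeleClassGroup L →ₜ* Circle) (hμ : IsConjugateSymplectic L μ), HasWeight L μ 1 →
        ∀ (a : (↥(maximalRealSubfield L))ˣ) (χ : Chi (↥(maximalRealSubfield L)) L (IsCMField.complexConj L)),
          ∃ (μ' : Literature.NumberTheory.Automorphic.IdeleClassGroup L →ₜ* Circle) (hμ' : IsConjugateSymplectic L μ'),
            HasWeight L μ' 1 ∧ (∀ τ : L →+* ℂ, τ ∈ hμ'.cmType.1 ↔ τ ∉ hμ.cmType.1) ∧
            (IsAdmissibleElement L hμ.cmType.1 (algebraMap (↥(maximalRealSubfield L)) L a * (2 * imagUnit L)⁻¹) →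
              IsAdmissibleElement L hμ'.cmType.1
                (algebraMap (↥(maximalRealSubfield L)) L (↑(-a : (↥(maximalRealSubfield L))ˣ)) * (2 * imagUnit L)⁻¹)) ∧
            ∃ e : Representation.IntertwiningMap
                (ConjVec.repConj
                  (rhoAtLine (↥(maximalRealSubfield L)) L (IsCMField.complexConj L) 3 e₁ (Matrix.diagonal dV)
                    (complexConj_imagUnit L) (imagUnit_ne_zero L) (imagUnit_mul_self L) (realDiagonal_isSymm L dV hdV)
                    (isUnit_det_realDiagonal L dV hdV hdV0) (realDiagonal_map L dV hdV).symm
                    (fun a => isCompatible_chiSplittingLine L e₁ dV hdV hdV0 (toHeckeCharacter L μ')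
                      (isUnitary_toHeckeCharacter L μ') ((isOscillatorChar_toHeckeCharacter_iff μ').mpr hμ')
                      (TW (↥(maximalRealSubfield L)) a) (isSymm_TW (↥(maximalRealSubfield L)) a)
                      (isUnit_det_TW (↥(maximalRealSubfield L)) a) (JW (↥(maximalRealSubfield L)) L a)
                      (JW_eq (↥(maximalRealSubfield L)) L a)) ιV (-a) ⟨(Units.map ((starRingEnd ℂ : ℂ →+* ℂ) : ℂ →* ℂ)).comp χ.1,
                    isAutomorphicOneChar_unitsMap_comp_chi (IsCMField.complexConj L) χ _⟩))
                (rhoAtLine (↥(maximalRealSubfield L)) L (IsCMField.complexConj L) 3 e₁ (Matrix.diagonal dV)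
                  (complexConj_imagUnit L) (imagUnit_ne_zero L) (imagUnit_mul_self L) (realDiagonal_isSymm L dV hdV)
                  (isUnit_det_realDiagonal L dV hdV hdV0) (realDiagonal_map L dV hdV).symm
                  (fun a => isCompatible_chiSplittingLine L e₁ dV hdV hdV0 (toHeckeCharacter L μ)
                    (isUnitary_toHeckeCharacter L μ) ((isOscillatorChar_toHeckeCharacter_iff μ).mpr hμ)
                    (TW (↥(maximalRealSubfield L)) a) (isSymm_TW (↥(maximalRealSubfield L)) a)
                    (isUnit_det_TW (↥(maximalRealSubfield L)) a) (JW (↥(maximalRealSubfield L)) L a)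
                    (JW_eq (↥(maximalRealSubfield L)) L a)) ιV a χ),
              Function.Bijective e := by
  sorry

set_option synthInstance.maxHeartbeats 400000 in
set_option maxHeartbeats 16000000 in
/-- **sig OR-1R `sig_K2E2OrConjLinearPartnerAtLineFramed` (#17R, ED. 2 — R8 (b) TWIN of #17 requested by K2E2-p06 21:44:01Z; DEALT TO K2E2-p06).**  = #17 with the
four FRAME binders `(ι : L →+* ℂ)`, `(T : GL (Fin 3) ℂ)`, `(hT : Tᴴ·H^ι·T = J)`, `hpos : ∀ τ' ≠ ι, (H.map τ').PosDef →` inserted after `[IsCMField L]` ∕ around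
`(H : Matrix (Fin 3) (Fin 3) L)` — NOTHING ELSE CHANGED (token diff vs #17 = exactly these binders; `2 ≤ finrank ℚ L⁺` deliberately NOT added: ★ J has no
anisotropy hypothesis).  WHY: #17 is TRUE as typed ([Liu2021, Lem. D.1 (2)] is local, any signature) but its `(ι,T)`-free proof would re-run ★ J-b∕J-c
(`H413MirrorSplittingAtScalar`, `Item6CentralTypeAtPinConj.hasCentralTypeAt_neg_of_conj_of_val_eq_neg`, `H413MirrorAtPinLine` §2∕§4) in generic `dV`
currency = L∕XL; with the frame binders the in-tree road is M: `V := hermSpace3Of L ι H T hT hpos` over `cmFieldOf L` (★ `F0P2OccGenCotangentOfOccursIn` :83) ▸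
★ J `H413MirrorAtPinLine.exists_conjPartner_omegaAtLine_neg` at the frame of record (`frameD V`, model `e₁`, `hsChiD`) gives `μ′` (weight one, `HasCMType μ′ Φ̄_μ`
⟹ clause 2 by ★ `cmType_eq` + `mem_bar_iff`; clause 3 by ★ `isAdmissibleElement_conj_neg_iff` + `coe_bar_eq_setOf_conjugate_mem`, as ★ `F0P2tThetaOccursInGenNeg`
:219–226) and the semilinear bijective equivariant `J` ▸ generic transports to the socket's frame ∕ enumeration on both sides (★
`exists_omegaAtLine_equiv_rhoVAtLine_of_isometry` (Def411WeilCarriersAtLineFrameTransportOfIsometry; rational isometry between `diag dV` and `diag (frameD V)` from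
`g`, ★ `frame_congr` ∕ `frameG`) ∘ ★ `exists_omegaAtLine_equiv_rhoVAtLine_reindex`) ▸ `J_gen := Ψ′⁻¹ ∘ J ∘ Ψ` semilinear bijective, `rhoVAtLine`-equivariant at every
`k ∈ U(diag dV)(𝔸_f)`, hence `rhoAtLine … ιV`-equivariant (pull-back; `hιV` idle) ▸ glue `nonempty_equiv_repConj_of_semilinear_symm` (p06 a0dff875) ▸ `e` bijective.
The closer #18 carries all four binders, so it instantiates #17R at no cost.  #17 stays in this file, bytes FROZEN, marked SUPERSEDED (true, unpriced road) —
DO NOT PROVE #17; prove #17R.  Why it might fail: currency-adapter bookkeeping only.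
[cite: Liu2021, Def. 4.11 (l. 2092–2096); App. D Lem. D.1 (2) (l. 5231); Rem. 4.4] [cite: GelbartRogawski1991, §3.1 Prop. 3.1.1 p. 455; Remark p. 457] [cite: Li1992, p. 181]
[cite: Clozel1990, §3.1]
size: M · deps: ★ `H413MirrorAtPinLine`, ★ `hermSpace3Of` ∕ `cmFieldOf`, ★ frame-transport-of-isometry ∕ reindex, ★ `ConjVec.repConj`, ★ admissibility neg-iff ·
unit: ORIENT · holder: K2E2-p06 · tier-2 target `Theorems/K2E2OrConjLinearPartnerAtLineFramed.lean` (or p06's `…PartnerAtLine.lean` with this head name) -/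
theorem sig_K2E2OrConjLinearPartnerAtLineFramed :
    ∀ (L : Type) [Field L] [NumberField L] [IsCMField L] (ι : L →+* ℂ) (H : Matrix (Fin 3) (Fin 3) L) (T : GL (Fin 3) ℂ)
      (hT : (T : Matrix (Fin 3) (Fin 3) ℂ)ᴴ * H.map ι * (T : Matrix (Fin 3) (Fin 3) ℂ) = Literature.Geometry.ComplexHyperbolic.BallModel.J),
      (∀ τ' : L →+* ℂ, InfinitePlace.mk τ' ≠ InfinitePlace.mk ι → (H.map τ').PosDef) →
    ∀ {n' : ℕ} (e₁ : Fin 3 × Fin 1 ≃ Fin n') (dV : Fin 3 → L) (hdV : ∀ i, IsCMField.complexConj L (dV i) = dV i)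
      (hdV0 : ∀ i, dV i ≠ 0) (g : GL (Fin 3) L)
      (hg : ((g : Matrix (Fin 3) (Fin 3) L).map (cmConjRingHom L))ᵀ * H * (g : Matrix (Fin 3) (Fin 3) L) = Matrix.diagonal dV)
      (ιV : finAdelic (↥(maximalRealSubfield L)) L (IsCMField.complexConj L) 3 H →*
          finAdelic (↥(maximalRealSubfield L)) L (IsCMField.complexConj L) 3 (Matrix.diagonal dV)),
        (∀ k, ((ιV k : finAdelic (↥(maximalRealSubfield L)) L (IsCMField.complexConj L) 3 (Matrix.diagonal dV)) :
            GL (Fin 3) (FiniteAdeleRing (𝓞 L) L)) =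
          (toFinAdeleGL L 3 g)⁻¹ * (k : GL (Fin 3) (FiniteAdeleRing (𝓞 L) L)) * toFinAdeleGL L 3 g) →
      ∀ (μ : Literature.NumberTheory.Automorphic.IdeleClassGroup L →ₜ* Circle) (hμ : IsConjugateSymplectic L μ), HasWeight L μ 1 →
        ∀ (a : (↥(maximalRealSubfield L))ˣ) (χ : Chi (↥(maximalRealSubfield L)) L (IsCMField.complexConj L)),
          ∃ (μ' : Literature.NumberTheory.Automorphic.IdeleClassGroup L →ₜ* Circle) (hμ' : IsConjugateSymplectic L μ'),
            HasWeight L μ' 1 ∧ (∀ τ : L →+* ℂ, τ ∈ hμ'.cmType.1 ↔ τ ∉ hμ.cmType.1) ∧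
            (IsAdmissibleElement L hμ.cmType.1 (algebraMap (↥(maximalRealSubfield L)) L a * (2 * imagUnit L)⁻¹) →
              IsAdmissibleElement L hμ'.cmType.1
                (algebraMap (↥(maximalRealSubfield L)) L (↑(-a : (↥(maximalRealSubfield L))ˣ)) * (2 * imagUnit L)⁻¹)) ∧
            ∃ e : Representation.IntertwiningMap
                (ConjVec.repConj
                  (rhoAtLine (↥(maximalRealSubfield L)) L (IsCMField.complexConj L) 3 e₁ (Matrix.diagonal dV)
                    (complexConj_imagUnit L) (imagUnit_ne_zero L) (imagUnit_mul_self L) (realDiagonal_isSymm L dV hdV)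
                    (isUnit_det_realDiagonal L dV hdV hdV0) (realDiagonal_map L dV hdV).symm
                    (fun a => isCompatible_chiSplittingLine L e₁ dV hdV hdV0 (toHeckeCharacter L μ')
                      (isUnitary_toHeckeCharacter L μ') ((isOscillatorChar_toHeckeCharacter_iff μ').mpr hμ')
                      (TW (↥(maximalRealSubfield L)) a) (isSymm_TW (↥(maximalRealSubfield L)) a)
                      (isUnit_det_TW (↥(maximalRealSubfield L)) a) (JW (↥(maximalRealSubfield L)) L a)
                      (JW_eq (↥(maximalRealSubfield L)) L a)) ιV (-a) ⟨(Units.map ((starRingEnd ℂ : ℂ →+* ℂ) : ℂ →* ℂ)).comp χ.1,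
                    isAutomorphicOneChar_unitsMap_comp_chi (IsCMField.complexConj L) χ _⟩))
                (rhoAtLine (↥(maximalRealSubfield L)) L (IsCMField.complexConj L) 3 e₁ (Matrix.diagonal dV)
                  (complexConj_imagUnit L) (imagUnit_ne_zero L) (imagUnit_mul_self L) (realDiagonal_isSymm L dV hdV)
                  (isUnit_det_realDiagonal L dV hdV hdV0) (realDiagonal_map L dV hdV).symm
                  (fun a => isCompatible_chiSplittingLine L e₁ dV hdV hdV0 (toHeckeCharacter L μ)
                    (isUnitary_toHeckeCharacter L μ) ((isOscillatorChar_toHeckeCharacter_iff μ).mpr hμ)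
                    (TW (↥(maximalRealSubfield L)) a) (isSymm_TW (↥(maximalRealSubfield L)) a)
                    (isUnit_det_TW (↥(maximalRealSubfield L)) a) (JW (↥(maximalRealSubfield L)) L a)
                    (JW_eq (↥(maximalRealSubfield L)) L a)) ιV a χ),
              Function.Bijective e :=
  @Summit.HodgeConjecture.HodgeConjecture.Cruxes.H413.K2E2OrConjLinearPartnerAtLineFramed.orConjLinearPartnerAtLineFramed  -- ★ RE-TIED BY IMPORT (ED. 3; statement bytes above FROZEN ∕ unchanged)

set_option synthInstance.maxHeartbeats 400000 in
set_option maxHeartbeats 16000000 in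
/-- **sig OR-2 `sig_K2E2OrAntiholWitnessOfNeg` (#18, closer, size S given #17 + #12R) = the tier-0 stub `StubAntiholWitnessOfNeg` VERBATIM.**  TEL frame, pinned
`ιA` ∕ `ιV`, `[U(diag dV)]` compact, automorphic `μA`: a NEGATIVELY oriented (`ι ∉ Φ_μ`) admissible weight-one label `(μ, ⟨a⟩, χ)` has an ANTIholomorphic-cotangent
discrete carrier `P″` (`P″.HasFinComponent ω_H(μ,a,χ)[ιV]`).  PLAN: #17 gives the partner `(μ′, −a, χ̄)`, positively oriented (`ι ∈ Φ_(μ′)`) and admissible; #12R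
(`Capture.sig_K2E2CapHolThetaWitnessOriented`) gives a non-zero pinned theta class all of whose receivers are hol-cotangent with finite component `ω_H(μ′,−a,χ̄)[ιV]`;
a receiver `P′` exists (`θ ≠ 0` in the discretely decomposable `L²`: ★ `isDiscretelyDecomposable_rightRegular_adelicGroupData`, `H` anisotropic from `hpos` ★
`anisotropic_of_posDef_map`; pattern ★ `F0LD2MeetsOfNonOrthogonal`); `P″ := P′.conj` is antihol-cotangent (★ `isHolCotangentAt_iff_conj`) with finite component
`repConj ω_H(μ′,−a,χ̄)[ιV]` (★ `hasFinComponent_conj_repConj`), hence `ω_H(μ,a,χ)[ιV]` by #17's bijective intertwiner and ★ #6 `trHasFinComponentOfBijective`.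
Re-ties tier-0 `stub_antiholWitnessOfNeg`.  Why it might fail: no risk beyond #17 and #12R.
[cite: Liu2021, proof of Prop. 4.13 Case 1 (l. 2129–2137); App. D Lem. D.1 (2), Lem. D.2 (2)] [cite: BorelJacquet1979, §4.6] [cite: BorelWallach2000, VII 2.10, 3.2]
[cite: DeitmarEchterhoff2014, Thm. 9.2.2]
size: S · deps: #17, #12R, ★ #6, ★ conj kit · unit: ORIENT · tier-2 target `Theorems/K2E2OrAntiholWitnessOfNeg.lean` -/
theorem sig_K2E2OrAntiholWitnessOfNeg :
    ∀ (L : Type) [Field L] [NumberField L] [IsCMField L] (ι : L →+* ℂ) (H : Matrix (Fin 3) (Fin 3) L) (T : GL (Fin 3) ℂ)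
      (hT : (T : Matrix (Fin 3) (Fin 3) ℂ)ᴴ * H.map ι * (T : Matrix (Fin 3) (Fin 3) ℂ) = Literature.Geometry.ComplexHyperbolic.BallModel.J),
      (∀ τ' : L →+* ℂ, InfinitePlace.mk τ' ≠ InfinitePlace.mk ι → (H.map τ').PosDef) → 2 ≤ Module.finrank ℚ ↥(maximalRealSubfield L) →
      ∀ {n' : ℕ} (e₁ : Fin 3 × Fin 1 ≃ Fin n') (dV : Fin 3 → L) (hdV : ∀ i, IsCMField.complexConj L (dV i) = dV i)
        (hdV0 : ∀ i, dV i ≠ 0) (g : GL (Fin 3) L)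
        (hg : ((g : Matrix (Fin 3) (Fin 3) L).map (cmConjRingHom L))ᵀ * H * (g : Matrix (Fin 3) (Fin 3) L) = Matrix.diagonal dV)
        (ιA : (adelicGroupData (↥(maximalRealSubfield L)) L (IsCMField.complexConj L) 3 H).Adelic →*
            ↥(UnitaryGroup.adelic (↥(maximalRealSubfield L)) L (IsCMField.complexConj L) 3 (Matrix.diagonal dV))),
          (∀ k, ((ιA k : ↥(UnitaryGroup.adelic (↥(maximalRealSubfield L)) L (IsCMField.complexConj L) 3 (Matrix.diagonal dV))) :
                GL (Fin 3) (AdeleRing (𝓞 L) L)) =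
              (toAdeleGL L g)⁻¹ * adelicVal (↥(maximalRealSubfield L)) L (IsCMField.complexConj L) 3 H k * toAdeleGL L g) →
        ∀ (ιV : finAdelic (↥(maximalRealSubfield L)) L (IsCMField.complexConj L) 3 H →*
            finAdelic (↥(maximalRealSubfield L)) L (IsCMField.complexConj L) 3 (Matrix.diagonal dV)),
          (∀ k, ((ιV k : finAdelic (↥(maximalRealSubfield L)) L (IsCMField.complexConj L) 3 (Matrix.diagonal dV)) :
              GL (Fin 3) (FiniteAdeleRing (𝓞 L) L)) =
            (toFinAdeleGL L 3 g)⁻¹ * (k : GL (Fin 3) (FiniteAdeleRing (𝓞 L) L)) * toFinAdeleGL L 3 g) →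
        ∀ [CompactSpace (↥(UnitaryGroup.adelic (↥(maximalRealSubfield L)) L (IsCMField.complexConj L) 3 (Matrix.diagonal dV)) ⧸
            (UnitaryGroup.toAdelic (↥(maximalRealSubfield L)) L (IsCMField.complexConj L) 3 (Matrix.diagonal dV)).range)],
        ∀ (μA : Measure (adelicGroupData (↥(maximalRealSubfield L)) L (IsCMField.complexConj L) 3 H).automorphicQuotient)
          [(adelicGroupData (↥(maximalRealSubfield L)) L (IsCMField.complexConj L) 3 H).IsAutomorphicMeasure μA]
          (μ : Literature.NumberTheory.Automorphic.IdeleClassGroup L →ₜ* Circle) (hμ : IsConjugateSymplectic L μ), HasWeight L μ 1 →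
            ι ∉ hμ.cmType.1 →
            ∀ (a : (↥(maximalRealSubfield L))ˣ) (χ : Chi (↥(maximalRealSubfield L)) L (IsCMField.complexConj L)),
              IsAdmissibleElement L hμ.cmType.1 (algebraMap (↥(maximalRealSubfield L)) L a * (2 * imagUnit L)⁻¹) →
              ∃ P'' : DiscreteAutomorphicRep (adelicGroupData (↥(maximalRealSubfield L)) L (IsCMField.complexConj L) 3 H) μA,
                P''.IsAntiholCotangentAt (cmArchSection L ι H T hT) (cmCompactFactor L ι H T hT) ∧
                P''.HasFinComponent
                  (rhoAtLine (↥(maximalRealSubfield L)) L (IsCMField.complexConj L) 3 e₁ (Matrix.diagonal dV)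
                  (complexConj_imagUnit L) (imagUnit_ne_zero L) (imagUnit_mul_self L) (realDiagonal_isSymm L dV hdV)
                  (isUnit_det_realDiagonal L dV hdV hdV0) (realDiagonal_map L dV hdV).symm
                  (fun a => isCompatible_chiSplittingLine L e₁ dV hdV hdV0 (toHeckeCharacter L μ)
                    (isUnitary_toHeckeCharacter L μ) ((isOscillatorChar_toHeckeCharacter_iff μ).mpr hμ)
                    (TW (↥(maximalRealSubfield L)) a) (isSymm_TW (↥(maximalRealSubfield L)) a)
                    (isUnit_det_TW (↥(maximalRealSubfield L)) a) (JW (↥(maximalRealSubfield L)) L a)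
                    (JW_eq (↥(maximalRealSubfield L)) L a)) ιV a χ) :=
  @Summit.HodgeConjecture.HodgeConjecture.Cruxes.H413.K2E2OrAntiholWitnessOfNeg.orAntiholWitnessOfNeg  -- ★ RE-TIED BY IMPORT (ED. 3; statement bytes above FROZEN ∕ unchanged)

end Summit.HodgeConjecture.HodgeConjecture.Cruxes.H413.K2E2ThetaExhaustionByRigidity.Orient

end
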